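import Summits.BirchSwinnertonDyer.BirchSwinnertonDyer.Theses.TameQuarticManinParity
import Summits.BirchSwinnertonDyer.BirchSwinnertonDyer.Theorems.TameQuarticManinParityTwistPairAtThree
import Literature.NumberTheory.EllipticCurves.SemistabilityDefectAtThreeTameWitnessProofs
import Summits.BirchSwinnertonDyer.BirchSwinnertonDyer.Theorems.TameQuarticManinParityPsiThreeRootValuationAtThree
import Mathlib.AlgebraicGeometry.EllipticCurve.DivisionPolynomial.Basic
import HarnessLib

/-!
# Route `TameQuarticManinParity`, LINE 21 (bsd-idea-3 g7), support L14a `TprimeKernelUnramifiedIffKodairaThree`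
# (stmt-BirchSwinnertonDyer-27956) — PROVED BY NAME: on a (t′) row at `3`, a rational root `x₀` of `Ψ₃` has
# `v₃(4x₀³ + b₂x₀² + 2b₄x₀ + b₆)` EVEN iff the curve is Kodaira III

Cell `pub/bsd-wall`, D-0145 line `route-BirchSwinnertonDyer-TeichmullerTwistDescent`, seat `bsd-line-ttd-p1` g9,
working the planner-of-record's TQMP LINE 21. BSD is NOT proved by this; Manin's conjecture is not proved by this;
V19/E19/U19 stay OPEN (this is the LOCAL law L14a; with R3, G21 it makes E19 ⟸ V19).

## Proof (elementary `3`-adic valuation arithmetic on the rational Tate normal forms)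

(t′) at `3` = Kodaira III (`v₃Δ_min = 3`) or III* (`v₃Δ_min = 9`). The tree's `ℚ`-RATIONAL Tate normal forms
(`exists_variableChange_tateNormalForm_III / _IIIstar`, from Silverman *ATAEC* IV.9.4 Steps 4 / 9 approximated
rationally) give `W' = C • W` with `v(a₁,a₂,a₃,a₄) ≥ 1, v(a₆) ≥ 2, v(Δ) = 3` (III), resp.
`v(a₁) ≥ 1, v(a₂) ≥ 2, v(a₃), v(a₄) ≥ 3, v(a₆) ≥ 5, v(Δ) = 9` (III*). From `v(Δ)` exactly: `v(b₄) = 1`, `v(b₈) = 2`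
(III), resp. `v(b₄) = 3`, `v(b₈) = 6` (III*). A root `x` of `Ψ₃ = 3x⁴ + b₂x³ + 3b₄x² + 3b₆x + b₈` then has `v(x) = 0`
(III) / `v(x) = 1` (III*) — any other valuation leaves a single dominant term — whence
`v(Ψ₂²(x)) = v(4x³ + b₂x² + 2b₄x + b₆) = 0` (III, EVEN), resp. `= 3` (III*, ODD). The change of variables moves the
root by `x = u²x' + r` and `Ψ₂²` by `u⁶`, which preserves the parity.

Design: theorems only; no definition, no named fact, no `sorry`; axioms `propext`, `Classical.choice`,
`Quot.sound`. References: [SilvermanATAEC1994] IV.9.4 Steps 4 and 9, Table 4.1; [SilvermanAEC2009] III §1 (change of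
variables), Ex. 3.7 (`Ψ₃`); [BarriosRoy2022] Thm. 3.4/3.5 (the printed shape of L14a).
-/

set_option autoImplicit false
-- D-0017: single-problem summit, so `Summit.BirchSwinnertonDyer.BirchSwinnertonDyer.…` repeats a namespace BY DESIGN.
set_option linter.dupNamespace false

noncomputable section

open scoped Classical

namespace Summit.BirchSwinnertonDyer.BirchSwinnertonDyer.Theorems.TameQuarticManinParity

open WeierstrassCurve IsDedekindDomain Rat.HeightOneSpectrum Polynomial WithZero
  Literature.NumberTheory.EllipticCurves Literature.NumberTheory.EllipticCurves.Rank1Residual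
  Summit.BirchSwinnertonDyer.Rank1Residual Summit.BirchSwinnertonDyer.Rank1Residual.Additive
  Summit.BirchSwinnertonDyer.BirchSwinnertonDyer.Theses.TameQuarticManinParity

/-! ## §1 Transport of `Ψ₃` and `Ψ₂²` along a change of variables -/

/-- `Ψ₃` has weight `8`: `u⁸ · Ψ₃^{C•W}(x') = Ψ₃^W(u²x' + r)`. [cite: SilvermanAEC2009, III §1 Table 3.1 and Ex. 3.7] -/
theorem eval_Ψ₃_variableChange (W : WeierstrassCurve ℚ) (C : VariableChange ℚ) (x' : ℚ) :
    (C • W).Ψ₃.eval x' * (C.u : ℚ) ^ 8 = W.Ψ₃.eval ((C.u : ℚ) ^ 2 * x' + C.r) := by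
  have hu0 : (C.u : ℚ) ≠ 0 := C.u.ne_zero
  simp only [WeierstrassCurve.Ψ₃, eval_add, eval_mul, eval_pow, eval_C, eval_X, eval_ofNat,
    variableChange_b₂, variableChange_b₄, variableChange_b₆, variableChange_b₈, Units.val_inv_eq_inv_val]
  field_simp
  ring

/-- `Ψ₂²` has weight `6`: `u⁶ · Ψ₂²^{C•W}(x') = Ψ₂²^W(u²x' + r)`. [cite: SilvermanAEC2009, III §1 Table 3.1] -/
theorem eval_Ψ₂Sq_variableChange (W : WeierstrassCurve ℚ) (C : VariableChange ℚ) (x' : ℚ) :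
    (C • W).Ψ₂Sq.eval x' * (C.u : ℚ) ^ 6 = W.Ψ₂Sq.eval ((C.u : ℚ) ^ 2 * x' + C.r) := by
  have hu0 : (C.u : ℚ) ≠ 0 := C.u.ne_zero
  simp only [WeierstrassCurve.Ψ₂Sq, eval_add, eval_mul, eval_pow, eval_C, eval_X,
    variableChange_b₂, variableChange_b₄, variableChange_b₆, Units.val_inv_eq_inv_val]
  field_simp
  ring

/-! ## §2 L14a by name -/

/-- Pulling a rational root of `Ψ₃^W` back to the model `C • W`. [folklore] -/
theorem eval_Ψ₃_pullback_eq_zero (W : WeierstrassCurve ℚ) (C : VariableChange ℚ) {x₀ : ℚ}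
    (hx₀ : W.Ψ₃.eval x₀ = 0) : (C • W).Ψ₃.eval ((x₀ - C.r) / (C.u : ℚ) ^ 2) = 0 := by
  have hu0 : (C.u : ℚ) ≠ 0 := C.u.ne_zero
  have hback : (C.u : ℚ) ^ 2 * ((x₀ - C.r) / (C.u : ℚ) ^ 2) + C.r = x₀ := by
    field_simp; ring
  have h := eval_Ψ₃_variableChange W C ((x₀ - C.r) / (C.u : ℚ) ^ 2)
  rw [hback, hx₀] at h
  exact (mul_eq_zero.mp h).resolve_right (pow_ne_zero _ hu0)

/-- The parity bookkeeping: `v₃(Ψ₂²^W(x₀)) = 6·v₃(u) + v₃(Ψ₂²^{C•W}(x'))` for `x' = (x₀ - r)/u²`. [folklore] -/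
theorem padicValRat_Ψ₂Sq_transport (W : WeierstrassCurve ℚ) (C : VariableChange ℚ) (x₀ : ℚ)
    {m : ℤ} (hD' : (placeOf 3).valuation ℚ ((C • W).Ψ₂Sq.eval ((x₀ - C.r) / (C.u : ℚ) ^ 2)) = exp (-m)) :
    padicValRat 3 (W.Ψ₂Sq.eval x₀) = 6 * padicValRat 3 (C.u : ℚ) + m := by
  have hu0 : (C.u : ℚ) ≠ 0 := C.u.ne_zero
  have hback : (C.u : ℚ) ^ 2 * ((x₀ - C.r) / (C.u : ℚ) ^ 2) + C.r = x₀ := by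
    field_simp; ring
  have htr := eval_Ψ₂Sq_variableChange W C ((x₀ - C.r) / (C.u : ℚ) ^ 2)
  rw [hback] at htr
  have hD'0 : (C • W).Ψ₂Sq.eval ((x₀ - C.r) / (C.u : ℚ) ^ 2) ≠ 0 := by
    intro h0; rw [h0, map_zero] at hD'; exact exp_ne_zero hD'.symm
  have hm : padicValRat 3 ((C • W).Ψ₂Sq.eval ((x₀ - C.r) / (C.u : ℚ) ^ 2)) = m := by
    have h := hD'
    rw [valuation_eq_exp_neg_padicValRat (placeOf 3) hD'0, natGenerator_placeOf_eq, exp_inj] at h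
    linarith
  rw [← htr, padicValRat.mul hD'0 (pow_ne_zero _ hu0), padicValRat.pow, hm]
  push_cast
  ring

/-- **L14a `TprimeKernelUnramifiedIffKodairaThree` (stmt-BirchSwinnertonDyer-27956), by name.** On a (t′) row at `3`
(`Addv W 3`, `SubTprime W 3`, `W` globally minimal) a rational root `x₀` of `Ψ₃` has `v₃(4x₀³ + b₂x₀² + 2b₄x₀ + b₆)`
even iff `v₃Δ_min(W) = 3` (Kodaira III): the local lemma (`TameQuarticManinParityPsiThreeRootValuationAtThree`) on the rational Tate normal forms, transported by §1.
[cite: SilvermanATAEC1994, IV.9.4 Steps 4, 9 and Table 4.1] [cite: SilvermanAEC2009, III §1 Table 3.1 and Ex. 3.7] -/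
theorem tprimeKernelUnramifiedIffKodairaThree_proof : TprimeKernelUnramifiedIffKodairaThree := by
  intro W _ _ hadd ht x₀ hx₀
  have hD : 4 * x₀ ^ 3 + W.b₂ * x₀ ^ 2 + 2 * W.b₄ * x₀ + W.b₆ = W.Ψ₂Sq.eval x₀ := by
    simp only [WeierstrassCurve.Ψ₂Sq, eval_add, eval_mul, eval_pow, eval_C, eval_X]
  rw [hD]
  haveI : PerfectField (IsLocalRing.ResidueField ((placeOf 3).adicCompletionIntegers ℚ)) :=
    PerfectField.ofFinite
  have h2 : ringChar (ℤ ⧸ (placeOf 3).asIdeal) ≠ 2 := by rw [ringChar_int_quot_placeOf 3]; decide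
  rcases TwistPairAtThree.kodairaSymbolAt_and_padicValInt_of_subTprime W hadd ht with ⟨hK, h3⟩ | ⟨hK, h9⟩
  · -- Kodaira III: the kernel character is unramified
    obtain ⟨C, c₁, c₂, c₃, c₄, c₆, cΔ⟩ := exists_variableChange_tateNormalForm_III (placeOf 3) W h2 hK
    have hval := valuation_Ψ₂Sq_eval_of_tateNormalForm_III (C • W) c₁ c₂ c₃ c₄ c₆ cΔ
      (eval_Ψ₃_pullback_eq_zero W C hx₀)
    have hpar := padicValRat_Ψ₂Sq_transport W C x₀ (m := 0) (by rw [neg_zero]; exact hval)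
    exact iff_of_true ⟨3 * padicValRat 3 (C.u : ℚ), by rw [hpar]; ring⟩ h3
  · -- Kodaira III*: the kernel character is ramified
    obtain ⟨C, c₁, c₂, c₃, c₄, c₆, cΔ⟩ := exists_variableChange_tateNormalForm_IIIstar (placeOf 3) W h2 hK
    have hval := valuation_Ψ₂Sq_eval_of_tateNormalForm_IIIstar (C • W) c₁ c₂ c₃ c₄ c₆ cΔ
      (eval_Ψ₃_pullback_eq_zero W C hx₀)
    have hpar := padicValRat_Ψ₂Sq_transport W C x₀ (m := 3) hval
    refine iff_of_false ?_ (by omega)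
    rintro ⟨k, hk⟩
    omega

end Summit.BirchSwinnertonDyer.BirchSwinnertonDyer.Theorems.TameQuarticManinParity
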